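/-
Copyright: statement-level skeleton of a published paper (lit-balaban cell, Phase-2 proof seat p30, gen 2). No proof
claims beyond what the kernel checks below.
-/
import Literature.MathematicalPhysics.QuantumFieldTheory.BalabanImbrieJaffe1984to88.BIJ85AppALemmas

/-!
# `BalabanImbrieJaffe1984to88.BIJ85Eq461Proof` — T. Bałaban, J. Imbrie, A. Jaffe, *Renormalization of the Higgs model:
minimizers, propagators and the stability of mean field theory*, Commun. Math. Phys. **97** (1985) 299–329
[BalabanImbrieJaffe1985]: Sect. 4.6 p. 313 — **(4.6.1)** the scalar propagator G_k(u_k) as a Gaussian functional integral and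
the sentence **(4.6.2)–(4.6.3)** *"Since no restrictions on φ occur in the Gaussian integral (4.6.1), we can also write G_k(u_k) =
[−Δ_{u_k} + a_kQ_k*(u_k)Q_k(u_k)]⁻¹"*, typed over finite-dimensional inner product spaces and PROVED (both directions) from
the Appendix-A Gaussian representation (A6) (`BIJ85AppALemmas.eqA6`)

statement-level skeleton of published theorems with citation tags; proofs where landed; nothing here is a claim about the Yang–Mills mass gap

PDF held: `paper:balaban1985-cmp97-bij-higgs-minimizers` (journal page = PDF page + 298).  Render read as an image: p. 313
(`HOME/lit-balaban-r15/pages/1985-cmp97-bij-higgs-minimizers-p015-x2.png`).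

CITATION HEADER (lean-in-tree rule).  Part of the lit-balaban TYPED SKELETON (HOME `run/shared/lean/pub/lit-balaban/`): WHAT IS
REPRODUCED = row **C1.Eq4.6.1** (`absent`) and the (4.6.2) sentence of row **C1.Eq4.6.2-4.6.4** (`typed p239474`: r15's
`BIJ85Sect4Statements.aK`, `deltaScalar`) of `HOME/lit-balaban-r15/ROWS-C1-part2.md`; fourth Appendix-A-based file of seat p30
gen 2 (after `BIJ85PropA1Proof`, `BIJ85AppALemmas`, `BIJ85PropA3Proof`); unit `lit-balaban-p30`.

THE PRINTED TEXT (verbatim, p. 313 [PDF 15]).  *"4.6. The Scalar Field Action.  The fundamental propagator G_k(u_k) for the scalar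
field in this theory can also be defined by a functional integral, exp(½⟨h, G_k(u_k)h⟩) = Z_k(u_k)⁻¹∫𝒟φ exp[−½‖D_{u_k}φ‖² −
½a_k‖Q_k(u_k)φ‖² + ⟨φ,h⟩]. (4.6.1)  Since no restrictions on φ occur in the Gaussian integral (4.6.1), we can also write G_k(u_k) =
[−Δ_{u_k} + a_kQ_k*(u_k)Q_k(u_k)]⁻¹, (4.6.2) where −Δ_{u_k} = D*_{u_k}D_{u_k}. (4.6.3) The coefficients a_k are produced by iterating
one-step renormalization transformations which use a constant a in the Gaussian. This yields a_k = a(1 − L⁻²)(1 − L^{−2k})⁻¹ in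
the k-step transformation [3]."*

THE TYPING.  The η-lattice scalar fields φ, the bond fields (values of D_{u_k}) and the unit-lattice fields (values of Q_k(u_k)) as
three finite-dimensional real inner product spaces `Φ`, `Ψ`, `Φ₁` (the complex scalar field of the U(1) model is a real inner product
space under Re⟨·,·⟩; p. 326 *"our space ℋ is finite dimensional"*); D_{u_k} = a linear `D : Φ → Ψ`, Q_k(u_k) = a linear `Q : Φ → Φ₁`
(their adjoints D*, Q* = Mathlib's `LinearMap.adjoint`); a_k = a real `ak` (the printed coefficient is r15's
`BIJ85Sect4Statements.aK a L k`; its positivity for a > 0, L > 1, k ≥ 1 is the landed `King1986.aK_pos` shape and is not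
restated here); 𝒟φ = the Lebesgue (`volume`) measure of `Φ`; Z_k(u_k) = the h = 0 integral.  The standing
condition under which (4.6.1) converges — the form ‖D_{u_k}φ‖² + a_k‖Q_k(u_k)φ‖² is positive definite (`hpos`; in finite dimension
⇔ coercive, `exists_coercive`) — is an explicit hypothesis; in the model it is the statement that a covariantly constant field with
vanishing block averages is zero, not proved here.  WHAT IS PROVED: `inner_op` (⟨φ,(D*D + a_kQ*Q)φ⟩ = ‖Dφ‖² + a_k‖Qφ‖², i.e.
(4.6.3) inserted), `exists_inverse` ([−Δ_{u_k} + a_kQ*Q]⁻¹ exists under `hpos`), **`eq461`** ((4.6.1) HOLDS for G = [−Δ_{u_k} +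
a_kQ*Q]⁻¹ — by `BIJ85AppALemmas.eqA6`, i.e. translation to the minimum), **`eq462`** (conversely, a symmetric G defined by
(4.6.1) IS that inverse: *"we can also write G_k(u_k) = [−Δ_{u_k} + a_kQ_k*Q_k]⁻¹"* — injectivity of exp and polarisation).
Carrier clauses (F6): the concrete lattice operators D_{u_k}, Q_k(u_k) are instance data; NOTHING of the paper is asserted beyond
the kernel-checked statements below.
-/

open scoped RealInnerProductSpace
open MeasureTheory

namespace Literature.MathematicalPhysics.QuantumFieldTheory.BalabanImbrieJaffe1984to88.BIJ85Eq461Proof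

open BIJ85AppALemmas

/-! ## Finite dimension: a positive-definite form is coercive (the convergence condition of (4.6.1)) -/

section Coercive

variable {Φ : Type*} [NormedAddCommGroup Φ] [InnerProductSpace ℝ Φ] [FiniteDimensional ℝ Φ]

/-- In finite dimension a positive-definite quadratic form ⟨φ,Tφ⟩ > 0 (φ ≠ 0) is coercive: ⟨φ,Tφ⟩ ≥ c‖φ‖² for some c > 0
(compactness of the unit sphere) — the form in which *"0 < Δ"* (p. 327) / the convergence of (4.6.1) enters the Gaussian lemmas.
[cite: BalabanImbrieJaffe1985, (4.6.1) p.313] -/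
theorem exists_coercive (T : Φ →ₗ[ℝ] Φ) (hpos : ∀ φ : Φ, φ ≠ 0 → 0 < ⟪φ, T φ⟫) :
    ∃ c : ℝ, 0 < c ∧ ∀ φ : Φ, c * ‖φ‖ ^ 2 ≤ ⟪φ, T φ⟫ := by
  by_cases hS : (Metric.sphere (0 : Φ) 1).Nonempty
  · have hT : Continuous T := T.continuous_of_finiteDimensional
    have hf : ContinuousOn (fun φ : Φ => ⟪φ, T φ⟫) (Metric.sphere (0 : Φ) 1) :=
      (continuous_id.inner hT).continuousOn
    obtain ⟨φ₀, hφ₀, hmin⟩ := (isCompact_sphere (0 : Φ) 1).exists_isMinOn hS hf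
    have hφ₀1 : ‖φ₀‖ = 1 := mem_sphere_zero_iff_norm.mp hφ₀
    have hφ₀0 : φ₀ ≠ 0 := by
      intro h
      rw [h, norm_zero] at hφ₀1
      exact zero_ne_one hφ₀1
    refine ⟨⟪φ₀, T φ₀⟫, hpos φ₀ hφ₀0, fun φ => ?_⟩
    by_cases hφ : φ = 0
    · simp [hφ]
    · have hn : ‖φ‖ ≠ 0 := norm_ne_zero_iff.mpr hφ
      have hu1 : ‖φ‖⁻¹ • φ ∈ Metric.sphere (0 : Φ) 1 := by
        rw [mem_sphere_zero_iff_norm, norm_smul, norm_inv, norm_norm, inv_mul_cancel₀ hn]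
      have hmin' : ⟪φ₀, T φ₀⟫ ≤ ⟪‖φ‖⁻¹ • φ, T (‖φ‖⁻¹ • φ)⟫ := (isMinOn_iff.mp hmin) _ hu1
      have key : ⟪‖φ‖⁻¹ • φ, T (‖φ‖⁻¹ • φ)⟫ = ‖φ‖⁻¹ * (‖φ‖⁻¹ * ⟪φ, T φ⟫) := by
        rw [map_smul, real_inner_smul_left, real_inner_smul_right]
      have key' : ⟪φ, T φ⟫ = ‖φ‖ ^ 2 * ⟪‖φ‖⁻¹ • φ, T (‖φ‖⁻¹ • φ)⟫ := by
        rw [key]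
        field_simp
      calc ⟪φ₀, T φ₀⟫ * ‖φ‖ ^ 2 ≤ ⟪‖φ‖⁻¹ • φ, T (‖φ‖⁻¹ • φ)⟫ * ‖φ‖ ^ 2 :=
            mul_le_mul_of_nonneg_right hmin' (sq_nonneg _)
        _ = ⟪φ, T φ⟫ := by rw [key', mul_comm]
  · refine ⟨1, one_pos, fun φ => ?_⟩
    have hφ : φ = 0 := by
      by_contra h
      apply hS
      refine ⟨‖φ‖⁻¹ • φ, ?_⟩
      rw [mem_sphere_zero_iff_norm, norm_smul, norm_inv, norm_norm, inv_mul_cancel₀ (norm_ne_zero_iff.mpr h)]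
    subst hφ
    simp

end Coercive

/-! ## (4.6.1)–(4.6.3) -/

section Eq461

variable {Φ Ψ Φ₁ : Type*} [NormedAddCommGroup Φ] [InnerProductSpace ℝ Φ] [FiniteDimensional ℝ Φ]
  [NormedAddCommGroup Ψ] [InnerProductSpace ℝ Ψ] [FiniteDimensional ℝ Ψ]
  [NormedAddCommGroup Φ₁] [InnerProductSpace ℝ Φ₁] [FiniteDimensional ℝ Φ₁]

variable (D : Φ →ₗ[ℝ] Ψ) (Q : Φ →ₗ[ℝ] Φ₁) (ak : ℝ)

/-- **(4.6.2)–(4.6.3)** p. 313: the operator −Δ_{u_k} + a_kQ*_k(u_k)Q_k(u_k) with −Δ_{u_k} = D*_{u_k}D_{u_k}, as D*D + a_k·Q*Q; its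
quadratic form is ‖D_{u_k}φ‖² + a_k‖Q_k(u_k)φ‖², the exponent of (4.6.1). [cite: BalabanImbrieJaffe1985, (4.6.3) p.313] -/
theorem inner_op (φ : Φ) :
    ⟪φ, (D.adjoint ∘ₗ D + ak • (Q.adjoint ∘ₗ Q)) φ⟫ = ‖D φ‖ ^ 2 + ak * ‖Q φ‖ ^ 2 := by
  simp only [LinearMap.add_apply, LinearMap.smul_apply, LinearMap.coe_comp, Function.comp_apply, inner_add_right,
    real_inner_smul_right, LinearMap.adjoint_inner_right, real_inner_self_eq_norm_sq]

/-- D*D + a_kQ*Q is symmetric. [cite: BalabanImbrieJaffe1985, (4.6.3) p.313] -/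
theorem op_symm (x y : Φ) :
    ⟪(D.adjoint ∘ₗ D + ak • (Q.adjoint ∘ₗ Q)) x, y⟫ = ⟪x, (D.adjoint ∘ₗ D + ak • (Q.adjoint ∘ₗ Q)) y⟫ := by
  simp only [LinearMap.add_apply, LinearMap.smul_apply, LinearMap.coe_comp, Function.comp_apply, inner_add_left,
    inner_add_right, real_inner_smul_left, real_inner_smul_right, LinearMap.adjoint_inner_left,
    LinearMap.adjoint_inner_right]

/-- The exponent of (4.6.1) at h = 0 is −½⟨φ,(D*D + a_kQ*Q)φ⟩. [cite: BalabanImbrieJaffe1985, (4.6.1) p.313] -/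
theorem exponent_eq (φ : Φ) :
    -(1 / 2 : ℝ) * ‖D φ‖ ^ 2 - (1 / 2 : ℝ) * ak * ‖Q φ‖ ^ 2
      = -(1 / 2 : ℝ) * ⟪φ, (D.adjoint ∘ₗ D + ak • (Q.adjoint ∘ₗ Q)) φ⟫ := by
  rw [inner_op]
  ring

/-- Under the convergence condition of (4.6.1) (`hpos`), [−Δ_{u_k} + a_kQ*Q]⁻¹ of (4.6.2) EXISTS (finite dimension: the operator is
injective), as a two-sided inverse. [cite: BalabanImbrieJaffe1985, (4.6.2) p.313] -/
theorem exists_inverse (hpos : ∀ φ : Φ, φ ≠ 0 → 0 < ‖D φ‖ ^ 2 + ak * ‖Q φ‖ ^ 2) :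
    ∃ G : Φ →ₗ[ℝ] Φ, (∀ φ, (D.adjoint ∘ₗ D + ak • (Q.adjoint ∘ₗ Q)) (G φ) = φ) ∧
      ∀ φ, G ((D.adjoint ∘ₗ D + ak • (Q.adjoint ∘ₗ Q)) φ) = φ := by
  have hinj : Function.Injective (D.adjoint ∘ₗ D + ak • (Q.adjoint ∘ₗ Q)) := by
    rw [← LinearMap.ker_eq_bot, LinearMap.ker_eq_bot']
    intro φ hφ
    by_contra hne
    have h := hpos φ hne
    rw [← inner_op, hφ, inner_zero_right] at h
    exact lt_irrefl _ h
  refine ⟨((LinearEquiv.ofInjectiveEndo _ hinj).symm : Φ →ₗ[ℝ] Φ), fun φ => ?_, fun φ => ?_⟩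
  · rw [LinearEquiv.coe_coe]
    have h := (LinearEquiv.ofInjectiveEndo _ hinj).apply_symm_apply φ
    rwa [LinearEquiv.coe_ofInjectiveEndo] at h
  · rw [LinearEquiv.coe_coe]
    have h := (LinearEquiv.ofInjectiveEndo _ hinj).symm_apply_apply φ
    rwa [LinearEquiv.coe_ofInjectiveEndo] at h

/-- The inverse of the symmetric operator D*D + a_kQ*Q is symmetric. [cite: BalabanImbrieJaffe1985, (4.6.2) p.313] -/
theorem inverse_symm (G : Φ →ₗ[ℝ] Φ) (hG : ∀ φ, (D.adjoint ∘ₗ D + ak • (Q.adjoint ∘ₗ Q)) (G φ) = φ) (x y : Φ) :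
    ⟪G x, y⟫ = ⟪x, G y⟫ := by
  conv_lhs => rw [← hG y]
  conv_rhs => rw [← hG x]
  rw [← op_symm]

variable [MeasurableSpace Φ] [BorelSpace Φ]

/-- **(4.6.1)** p. 313 [PDF 15], verbatim: *"The fundamental propagator G_k(u_k) for the scalar field in this theory can also be
defined by a functional integral, exp(½⟨h, G_k(u_k)h⟩) = Z_k(u_k)⁻¹∫𝒟φ exp[−½‖D_{u_k}φ‖² − ½a_k‖Q_k(u_k)φ‖² + ⟨φ,h⟩]. (4.6.1)"* —
HOLDS for G = [−Δ_{u_k} + a_kQ*Q]⁻¹ of (4.6.2) (`hG`), with Z_k(u_k) the h = 0 integral and 𝒟φ the Lebesgue measure of the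
finite-dimensional field space, under the convergence condition `hpos`; from (A6) (`BIJ85AppALemmas.eqA6`).
[cite: BalabanImbrieJaffe1985, (4.6.1) p.313] -/
theorem eq461 (hpos : ∀ φ : Φ, φ ≠ 0 → 0 < ‖D φ‖ ^ 2 + ak * ‖Q φ‖ ^ 2) (G : Φ →ₗ[ℝ] Φ)
    (hG : ∀ φ, (D.adjoint ∘ₗ D + ak • (Q.adjoint ∘ₗ Q)) (G φ) = φ) (h : Φ) :
    Real.exp ((1 / 2 : ℝ) * ⟪h, G h⟫)
      = (∫ φ : Φ, Real.exp (-(1 / 2 : ℝ) * ‖D φ‖ ^ 2 - (1 / 2 : ℝ) * ak * ‖Q φ‖ ^ 2))⁻¹ *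
        ∫ φ : Φ, Real.exp (-(1 / 2 : ℝ) * ‖D φ‖ ^ 2 - (1 / 2 : ℝ) * ak * ‖Q φ‖ ^ 2 + ⟪φ, h⟫) := by
  obtain ⟨c, hc, hcoer⟩ := exists_coercive (D.adjoint ∘ₗ D + ak • (Q.adjoint ∘ₗ Q))
    (fun φ hφ => by rw [inner_op]; exact hpos φ hφ)
  simp_rw [exponent_eq]
  exact eqA6 _ G (op_symm D Q ak) hc hcoer hG h

/-- **(4.6.2)** p. 313 [PDF 15], verbatim: *"Since no restrictions on φ occur in the Gaussian integral (4.6.1), we can also write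
G_k(u_k) = [−Δ_{u_k} + a_kQ_k*(u_k)Q_k(u_k)]⁻¹, (4.6.2) where −Δ_{u_k} = D*_{u_k}D_{u_k}. (4.6.3)"* — PROVED: a symmetric G
DEFINED by the functional integral (4.6.1) (`h461`, all h) is the inverse of D*D + a_kQ*Q (injectivity of exp, polarisation).
[cite: BalabanImbrieJaffe1985, (4.6.2) p.313] -/
theorem eq462 (hpos : ∀ φ : Φ, φ ≠ 0 → 0 < ‖D φ‖ ^ 2 + ak * ‖Q φ‖ ^ 2) (G : Φ →ₗ[ℝ] Φ)
    (hGs : ∀ x y : Φ, ⟪G x, y⟫ = ⟪x, G y⟫)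
    (h461 : ∀ h : Φ, Real.exp ((1 / 2 : ℝ) * ⟪h, G h⟫)
      = (∫ φ : Φ, Real.exp (-(1 / 2 : ℝ) * ‖D φ‖ ^ 2 - (1 / 2 : ℝ) * ak * ‖Q φ‖ ^ 2))⁻¹ *
        ∫ φ : Φ, Real.exp (-(1 / 2 : ℝ) * ‖D φ‖ ^ 2 - (1 / 2 : ℝ) * ak * ‖Q φ‖ ^ 2 + ⟪φ, h⟫)) :
    (D.adjoint ∘ₗ D + ak • (Q.adjoint ∘ₗ Q)) ∘ₗ G = LinearMap.id := by
  obtain ⟨G₀, hG₀, -⟩ := exists_inverse D Q ak hpos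
  -- the quadratic forms of G and G₀ agree
  have hq : ∀ h : Φ, ⟪h, G h⟫ = ⟪h, G₀ h⟫ := fun h => by
    have e := (h461 h).trans (eq461 D Q ak hpos G₀ hG₀ h).symm
    have e2 := Real.exp_injective e
    linarith
  -- polarisation: G − G₀ is symmetric with vanishing quadratic form
  have hT : ∀ x y : Φ, ⟪(G - G₀) x, y⟫ = ⟪x, (G - G₀) y⟫ := fun x y => by
    simp only [LinearMap.sub_apply, inner_sub_left, inner_sub_right, hGs, inverse_symm D Q ak G₀ hG₀]
  have hz : ∀ x : Φ, ⟪x, (G - G₀) x⟫ = 0 := fun x => by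
    rw [LinearMap.sub_apply, inner_sub_right, hq x, sub_self]
  have hzero : ∀ x y : Φ, ⟪x, (G - G₀) y⟫ = 0 := fun x y => by
    have h1 := hz (x + y)
    rw [map_add, inner_add_left, inner_add_right, inner_add_right, hz x, hz y, ← hT x y, real_inner_comm] at h1
    rw [← hT, real_inner_comm]
    linarith
  have hGG : G = G₀ := by
    rw [← sub_eq_zero]
    ext y
    exact ext_inner_left ℝ fun x => by rw [hzero x y, LinearMap.zero_apply, inner_zero_right]
  ext φ
  simp only [LinearMap.coe_comp, Function.comp_apply, LinearMap.id_coe, id_eq, hGG]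
  exact hG₀ φ

end Eq461

end Literature.MathematicalPhysics.QuantumFieldTheory.BalabanImbrieJaffe1984to88.BIJ85Eq461Proof
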